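import Mathlib
import Literature.Probability.LatticeModels.ProdBernoulliIndependence
import Literature.Probability.LatticeModels.ProdBernoulliClusterLocality
import Literature.Probability.Percolation.KozmaNitzanGoodQuadruple
import Summits.CriticalPhenomena.PercolationContinuityZ3.Theorems.PercNearOneGluingNearOneGluingPocketBound
import Summits.CriticalPhenomena.PercolationContinuityZ3.Theorems.PercNearOneGluingNearOneGluingPocketBoundAux
import Summits.CriticalPhenomena.PercolationContinuityZ3.Theorems.PercNearOneGluingNoHeavyLowerTailPocketSelectionBound
import Summits.CriticalPhenomena.PercolationContinuityZ3.Theorems.PercNearOneGluingNoHeavyLowerTailHubTransfer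
import HarnessLib

/-!
# `NoHeavyLowerTail` / `NearOneGluing` (stmt-CriticalPhenomena-4575 / 4574) — the BOUNDARY-BUDGET gluing bound
# and the DEPTH-TWO CLASS THEOREM

Helper file (lemma factory #1 `prim-lf-1`, gen 5; `--supports stmt-CriticalPhenomena-4575`).  No definitions, no
sorries.  Notation: `μ = prodBernoulli w` on the pairs of `Fin n`, relays `A`, observer `o ∉ A`, target `b ∈ A`;
the RELAY-FREE POCKET of `ω` is `{v | o ↔ v using only vertices outside A}` and
`Pock(S₀) = {ω | ∀ v, (o ↔ v in Aᶜ) ↔ v ∈ S₀}`; the KILLED PAIRS of a pocket value `S₀ ∋ o` are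
`K(S₀) = {pairs containing o} ∪ {boundary pairs s(x,y), x ∈ S₀, y ∉ S₀ ∪ A}`.

* `BoundaryBudget.pocket_inter_notConn_le` — for every vertex `c`:
  `μ(Pock(S₀) ∩ {c ↮ b}) ≤ μ(Pock(S₀)) · μ{ω | c ↮ b in ω ∖ K(S₀)}`.
  Proof: `Pock = Span ∩ Closed` (pairs inside `S₀` / boundary pairs), `{c ↮ b} ⊆ {c ↮ b in ω ∖ K}`, Harris for the
  increasing `Span` against the decreasing `Closed ∩ {c ↮ b in ω ∖ K}`, and independence of `Closed` (boundary pairs)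
  from `{c ↮ b in ω ∖ K}` (pairs off `K`).
* `BoundaryBudget.gluingDefect_le_sum` — THE BOUNDARY-BUDGET BOUND: with the landed pocket selection bound
  (`pocketSelectionBound'`, Kozma–Nitzan Thm 4 / Lemma 5 in the pocket-contracted world) and ANY admissible selection
  `sel`,  `μ(o ↔ A, o ↮ b) ≤ Σ_{S₀ ∋ o, S₀ ∩ A = ∅} μ(Pock(S₀)) · μ{sel S₀ ↮ b in ω ∖ K(S₀)}`;
  `exists_admissible` supplies an admissible `sel` with values in `A`; `sum_pocket_le_one`: the pockets partition.
* `BoundaryBudget.killed_transfer` — the per-pocket HUB/BOUNDARY TRANSFER (Harris, three decreasing events):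
  `μ{a ↮ b in ω ∖ K(S₀)} · (μ(o ↮ a) · μ(deep boundary of S₀ closed)) ≤ μ(a ↮ b)`.
* The depth-two consequences (the lead's depth-two theorem and Conjecture 3 on the depth-two class) are in the
  companion file `…NoHeavyLowerTailDepthTwoGluing.lean`.
-/

namespace Summit.CriticalPhenomena.PercolationContinuityZ3.Theorems

open scoped BigOperators Classical
open MeasureTheory Set
open Literature.Probability.LatticeModels (prodBernoulli prodBernoulli_real_inter_of_determinedBy
  prodBernoulli_harris_upper_lower prodBernoulli_harris_lower prodBernoulli_ae_forall_notMem)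
open Literature.Probability.Percolation

namespace BoundaryBudget

variable {n : ℕ}

/-! ### Paths and the pocket -/

/-- A path of a graph all of whose edges end in `S`, started in `S`, is a path inside `S`. -/
theorem pathIn_of_forall_adj_mem {G : SimpleGraph (Fin n)} {S : Set (Fin n)} {u v : Fin n}
    (hS : ∀ a b, G.Adj a b → b ∈ S) (hu : u ∈ S) (h : PathIn G Set.univ u v) : PathIn G S u v := by
  obtain ⟨-, h⟩ := h
  refine ⟨hu, ?_⟩
  induction h with
  | refl => exact Relation.ReflTransGen.refl
  | tail _ hbc ih => exact ih.tail ⟨hbc.1, hS _ _ hbc.1⟩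

/-- **`Span ∩ Closed ⊆ Pock`**: if `o ∈ S₀` reaches every vertex of `S₀` inside `S₀` and every boundary pair
of `S₀` (towards a vertex outside `S₀ ∪ A`) is closed, then the relay-free pocket of `o` is exactly `S₀`
(`S₀` disjoint from `A`).  Converse of the landed `mem_openConnIn_of_pocket` / `notMem_of_pocket`. -/
theorem pocket_of_span_of_closed {S₀ A : Finset (Fin n)} {o : Fin n} {F₀ : Finset (Sym2 (Fin n))}
    (ho : o ∈ S₀) (hSA : Disjoint S₀ A)
    (hF₀ : ∀ x y, s(x, y) ∈ F₀ ↔ (x ∈ S₀ ∧ y ∉ S₀ ∧ y ∉ A) ∨ (y ∈ S₀ ∧ x ∉ S₀ ∧ x ∉ A))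
    {ω : Set (Sym2 (Fin n))} (hspan : ∀ v ∈ S₀, ω ∈ openConnIn (↑S₀ : Set (Fin n)) o v)
    (hcl : ∀ e ∈ F₀, e ∉ ω) :
    ∀ v : Fin n, ω ∈ openConnIn (↑A : Set (Fin n))ᶜ o v ↔ v ∈ S₀ := by
  have hSAc : (↑S₀ : Set (Fin n)) ⊆ (↑A : Set (Fin n))ᶜ := fun x hx hxA =>
    Finset.disjoint_left.1 hSA (Finset.mem_coe.1 hx) (Finset.mem_coe.1 hxA)
  intro v
  constructor
  · intro hv
    by_contra hvS
    have hp : PathIn (openGraph ω) (↑A : Set (Fin n))ᶜ o v := DCT16.pathIn_of_mem_openConnIn hv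
    obtain ⟨x, y, hx, hy, hyA, hxy, -⟩ := hp.exit (R := (↑S₀ : Set (Fin n))) (Finset.mem_coe.2 ho)
      (fun h => hvS (Finset.mem_coe.1 h))
    rw [openGraph_adj] at hxy
    exact hcl _ ((hF₀ x y).2 (Or.inl ⟨Finset.mem_coe.1 hx, fun h => hy (Finset.mem_coe.2 h),
      fun h => hyA (Finset.mem_coe.2 h)⟩)) hxy.1
  · intro hv
    rw [DCT16.mem_openConnIn_iff_pathIn]
    exact (DCT16.pathIn_of_mem_openConnIn (hspan v hv)).mono hSAc

/-- **`Pock = Span ∩ Closed`** for a pocket value `S₀ ∋ o` disjoint from `A` and its boundary pair set `F₀`. -/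
theorem pocket_eq_span_inter_closed {S₀ A : Finset (Fin n)} {o : Fin n} {F₀ : Finset (Sym2 (Fin n))}
    (ho : o ∈ S₀) (hSA : Disjoint S₀ A)
    (hF₀ : ∀ x y, s(x, y) ∈ F₀ ↔ (x ∈ S₀ ∧ y ∉ S₀ ∧ y ∉ A) ∨ (y ∈ S₀ ∧ x ∉ S₀ ∧ x ∉ A)) :
    {ω : Set (Sym2 (Fin n)) | ∀ v : Fin n, ω ∈ openConnIn (↑A : Set (Fin n))ᶜ o v ↔ v ∈ S₀} =
      {ω | ∀ v ∈ S₀, ω ∈ openConnIn (↑S₀ : Set (Fin n)) o v} ∩ {ω | ∀ e ∈ F₀, e ∉ ω} := by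
  ext ω
  constructor
  · intro hω
    exact ⟨fun v hv => mem_openConnIn_of_pocket hω hv, fun e he => notMem_of_pocket hF₀ hω he⟩
  · rintro ⟨hspan, hcl⟩
    exact pocket_of_span_of_closed ho hSA hF₀ hspan hcl

/-- The killed pair set `K(S₀) = {pairs at o} ∪ {boundary pairs of S₀}` contains the boundary pair set `F₀`,
and equals `{e | o ∈ e} ∪ F₀`. -/
theorem killed_eq {S₀ A : Finset (Fin n)} {o : Fin n} {F₀ : Finset (Sym2 (Fin n))}
    (hF₀ : ∀ x y, s(x, y) ∈ F₀ ↔ (x ∈ S₀ ∧ y ∉ S₀ ∧ y ∉ A) ∨ (y ∈ S₀ ∧ x ∉ S₀ ∧ x ∉ A)) :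
    ({e : Sym2 (Fin n) | o ∈ e ∨ ∃ x ∈ S₀, ∃ y, y ∉ S₀ ∧ y ∉ A ∧ e = s(x, y)}) =
      {e : Sym2 (Fin n) | o ∈ e} ∪ (↑F₀ : Set (Sym2 (Fin n))) := by
  ext e
  induction e using Sym2.ind with
  | _ u v =>
  simp only [mem_setOf_eq, mem_union, Finset.mem_coe]
  refine or_congr Iff.rfl ⟨?_, ?_⟩
  · rintro ⟨x, hx, y, hy, hyA, hxy⟩
    rw [hxy]
    exact (hF₀ x y).2 (Or.inl ⟨hx, hy, hyA⟩)
  · intro h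
    rcases (hF₀ u v).1 h with ⟨hu, hv, hvA⟩ | ⟨hv, hu, huA⟩
    · exact ⟨u, hu, v, hv, hvA, rfl⟩
    · exact ⟨v, hv, u, hu, huA, Sym2.eq_swap⟩

/-! ### The per-pocket inequality -/

/-- **Per-pocket boundary-budget inequality.**  For a pocket value `S₀ ∋ o` disjoint from `A` and any
vertices `c, b`:  `μ(Pock(S₀) ∩ {c ↮ b}) ≤ μ(Pock(S₀)) · μ{ω | c ↮ b in ω ∖ K(S₀)}`, where
`K(S₀) = {e | o ∈ e} ∪ {s(x,y) | x ∈ S₀, y ∉ S₀ ∪ A}`.  (`Pock = Span ∩ Closed`; `{c ↮ b} ⊆ {c ↮ b in ω ∖ K}`;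
Harris for `Span` increasing against `Closed ∩ {c ↮ b in ω ∖ K}` decreasing; independence of `Closed` from the
event on `Kᶜ`; `μ(Span)·μ(Closed) = μ(Pock)` by independence again.) -/
theorem pocket_inter_notConn_le (w : Sym2 (Fin n) → unitInterval) {S₀ A : Finset (Fin n)} {o : Fin n}
    (ho : o ∈ S₀) (hSA : Disjoint S₀ A) (c b : Fin n) :
    (prodBernoulli w).real
        ({ω : Set (Sym2 (Fin n)) | ∀ v : Fin n, ω ∈ openConnIn (↑A : Set (Fin n))ᶜ o v ↔ v ∈ S₀} ∩
          (openConn c b)ᶜ) ≤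
      (prodBernoulli w).real
          {ω : Set (Sym2 (Fin n)) | ∀ v : Fin n, ω ∈ openConnIn (↑A : Set (Fin n))ᶜ o v ↔ v ∈ S₀} *
        (prodBernoulli w).real
          {ω : Set (Sym2 (Fin n)) |
            ω \ {e : Sym2 (Fin n) | o ∈ e ∨ ∃ x ∈ S₀, ∃ y, y ∉ S₀ ∧ y ∉ A ∧ e = s(x, y)} ∉ openConn c b} := by
  obtain ⟨F₀, hF₀⟩ := exists_boundaryPairs S₀ A (n := n)
  set μ := prodBernoulli w with hμ
  set K : Set (Sym2 (Fin n)) := {e | o ∈ e ∨ ∃ x ∈ S₀, ∃ y, y ∉ S₀ ∧ y ∉ A ∧ e = s(x, y)} with hK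
  set Span : Set (Set (Sym2 (Fin n))) := {ω | ∀ v ∈ S₀, ω ∈ openConnIn (↑S₀ : Set (Fin n)) o v}
    with hSpan
  set Cl : Set (Set (Sym2 (Fin n))) := {ω | ∀ e ∈ F₀, e ∉ ω} with hCl
  set D : Set (Set (Sym2 (Fin n))) := {ω | ω \ K ∉ openConn c b} with hD
  set Pock : Set (Set (Sym2 (Fin n))) :=
    {ω | ∀ v : Fin n, ω ∈ openConnIn (↑A : Set (Fin n))ᶜ o v ↔ v ∈ S₀} with hPock
  have hPock_eq : Pock = Span ∩ Cl := pocket_eq_span_inter_closed ho hSA hF₀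
  have hKeq : K = {e : Sym2 (Fin n) | o ∈ e} ∪ (↑F₀ : Set (Sym2 (Fin n))) := killed_eq hF₀
  have hF₀K : (↑F₀ : Set (Sym2 (Fin n))) ⊆ K := by rw [hKeq]; exact subset_union_right
  -- `{c ↮ b} ⊆ D`
  have hsubD : (openConn c b : Set (Set (Sym2 (Fin n))))ᶜ ⊆ D := fun ω hω hω' =>
    hω (isUpperSet_openConn c b sdiff_le hω')
  -- monotonicity types
  have hSpanU : IsUpperSet Span := by
    intro ω ω' hle hω v hv
    exact isUpperSet_openConnIn _ _ _ hle (hω v hv)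
  have hClL : IsLowerSet Cl := fun ω ω' hle hω e he heω' => hω e he (hle heω')
  have hDL : IsLowerSet D := fun ω ω' hle hω hω' =>
    hω (isUpperSet_openConn c b (sdiff_le_sdiff_right hle) hω')
  -- pair-set bookkeeping
  have hF₀S : (↑F₀ : Set (Sym2 (Fin n))) ⊆ (↑S₀.sym2 : Set (Sym2 (Fin n)))ᶜ := by
    intro e he heS
    rw [Finset.mem_coe] at he heS
    revert he heS
    induction e using Sym2.ind with
    | _ x y =>
    intro he heS
    rw [Finset.mk_mem_sym2_iff] at heS
    rcases (hF₀ x y).1 he with ⟨-, hy, -⟩ | ⟨-, hx, -⟩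
    exacts [hy heS.2, hx heS.1]
  have hDdet : DeterminedBy D (↑F₀ : Set (Sym2 (Fin n)))ᶜ := by
    have hDK : DeterminedBy D Kᶜ := by
      rw [determinedBy_iff]
      intro ω ω' h
      have : ω \ K = ω' \ K := by
        ext e
        have he := Set.ext_iff.1 h e
        simp only [mem_inter_iff, mem_compl_iff, mem_sdiff] at he ⊢
        exact he
      simp only [hD, mem_setOf_eq, this]
    exact hDK.mono (compl_subset_compl.2 hF₀K)
  -- the chain
  calc μ.real (Pock ∩ (openConn c b)ᶜ)
      ≤ μ.real (Span ∩ (Cl ∩ D)) := by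
        refine measureReal_mono (fun ω hω => ?_) (measure_ne_top _ _)
        rw [hPock_eq] at hω
        exact ⟨hω.1.1, hω.1.2, hsubD hω.2⟩
    _ ≤ μ.real Span * μ.real (Cl ∩ D) :=
        prodBernoulli_harris_upper_lower w hSpanU (hClL.inter hDL) MeasurableSet.of_discrete
          MeasurableSet.of_discrete
    _ = μ.real Span * (μ.real Cl * μ.real D) := by
        rw [prodBernoulli_real_inter_of_determinedBy w F₀ (determinedBy_forall_notMem F₀) hDdet
          MeasurableSet.of_discrete MeasurableSet.of_discrete]
    _ = μ.real (Span ∩ Cl) * μ.real D := by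
        rw [prodBernoulli_real_inter_of_determinedBy w S₀.sym2 (determinedBy_span S₀ o)
          ((determinedBy_forall_notMem F₀).mono hF₀S) MeasurableSet.of_discrete MeasurableSet.of_discrete]
        ring
    _ = μ.real Pock * μ.real D := by rw [hPock_eq]

/-! ### The boundary-budget bound -/

/-- **An admissible selection exists** (with values in `A ∋ b`): for every pocket shape take a relay minimising
the connection probability to `b` in `G − S₀` (all pairs touching `S₀` closed); it is trivially at most as
reliable as every relay neighbour of `S₀`. -/
theorem exists_admissible (w : Sym2 (Fin n) → unitInterval) (A : Finset (Fin n)) {b : Fin n} (hb : b ∈ A) :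
    ∃ sel : Finset (Fin n) → Fin n, (∀ S₀, sel S₀ ∈ A) ∧
      ∀ S₀ : Finset (Fin n), ∀ v ∈ A,
        (prodBernoulli (pinW w (edgesTouching (↑S₀ : Set (Fin n))) (∅ : Set (Sym2 (Fin n))))).real
            (openConn (sel S₀) b) ≤
          (prodBernoulli (pinW w (edgesTouching (↑S₀ : Set (Fin n))) (∅ : Set (Sym2 (Fin n))))).real
            (openConn v b) := by
  have hne : A.Nonempty := ⟨b, hb⟩
  have key : ∀ S₀ : Finset (Fin n), ∃ a ∈ A, ∀ v ∈ A,
      (prodBernoulli (pinW w (edgesTouching (↑S₀ : Set (Fin n))) (∅ : Set (Sym2 (Fin n))))).real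
          (openConn a b) ≤
        (prodBernoulli (pinW w (edgesTouching (↑S₀ : Set (Fin n))) (∅ : Set (Sym2 (Fin n))))).real
          (openConn v b) :=
    fun S₀ => Finset.exists_min_image A _ hne
  choose sel hselA hsel using key
  exact ⟨sel, hselA, hsel⟩

/-- **The boundary-budget bound.**  For `o ∉ A`, `b ∈ A` and an admissible selection rule `sel` (as in the landed
`pocketSelectionBound'`):
`μ(o ↔ A, o ↮ b) ≤ Σ_{S₀ ∋ o, S₀ ∩ A = ∅} μ(Pock(S₀)) · μ{sel S₀ ↮ b in ω ∖ K(S₀)}`. -/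
theorem gluingDefect_le_sum (w : Sym2 (Fin n) → unitInterval) (A : Finset (Fin n)) (o b : Fin n)
    (sel : Finset (Fin n) → Fin n) (hoA : o ∉ A) (hb : b ∈ A)
    (hadm : ∀ S₀ : Finset (Fin n), o ∈ S₀ → Disjoint S₀ A → ∀ v ∈ A, (∃ x ∈ S₀, w s(x, v) ≠ 0) →
      (prodBernoulli (pinW w (edgesTouching (↑S₀ : Set (Fin n))) (∅ : Set (Sym2 (Fin n))))).real
          (openConn (sel S₀) b) ≤
        (prodBernoulli (pinW w (edgesTouching (↑S₀ : Set (Fin n))) (∅ : Set (Sym2 (Fin n))))).real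
          (openConn v b)) :
    (prodBernoulli w).real ((⋃ a ∈ A, openConn o a) ∩ (openConn o b)ᶜ) ≤
      ∑ S₀ ∈ (Finset.univ : Finset (Finset (Fin n))).filter (fun S₀ => o ∈ S₀ ∧ Disjoint S₀ A),
        (prodBernoulli w).real
            {ω : Set (Sym2 (Fin n)) | ∀ v : Fin n, ω ∈ openConnIn (↑A : Set (Fin n))ᶜ o v ↔ v ∈ S₀} *
          (prodBernoulli w).real
            {ω : Set (Sym2 (Fin n)) |
              ω \ {e : Sym2 (Fin n) | o ∈ e ∨ ∃ x ∈ S₀, ∃ y, y ∉ S₀ ∧ y ∉ A ∧ e = s(x, y)} ∉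
                openConn (sel S₀) b} := by
  refine (pocketSelectionBound' n w A o b sel hoA hb hadm).trans (Finset.sum_le_sum fun S₀ hS₀ => ?_)
  simp only [Finset.mem_filter, Finset.mem_univ, true_and] at hS₀
  obtain ⟨hoS, hSA⟩ := hS₀
  have hsub : ({ω : Set (Sym2 (Fin n)) | ∀ v : Fin n, ω ∈ openConnIn (↑A : Set (Fin n))ᶜ o v ↔ v ∈ S₀} ∩
        ((⋃ a ∈ A, openConn o a) ∩ (openConn (sel S₀) b)ᶜ)) ⊆
      ({ω : Set (Sym2 (Fin n)) | ∀ v : Fin n, ω ∈ openConnIn (↑A : Set (Fin n))ᶜ o v ↔ v ∈ S₀} ∩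
        (openConn (sel S₀) b)ᶜ) := fun ω hω => ⟨hω.1, hω.2.2⟩
  exact (measureReal_mono hsub (measure_ne_top _ _)).trans (pocket_inter_notConn_le w hoS hSA (sel S₀) b)

/-- **The pockets partition**: `Σ_{S₀ ∋ o, S₀ ∩ A = ∅} μ(Pock(S₀)) ≤ 1` (the pocket of `ω` is one set). -/
theorem sum_pocket_le_one (w : Sym2 (Fin n) → unitInterval) (A : Finset (Fin n)) (o : Fin n) :
    ∑ S₀ ∈ (Finset.univ : Finset (Finset (Fin n))).filter (fun S₀ => o ∈ S₀ ∧ Disjoint S₀ A),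
        (prodBernoulli w).real
          {ω : Set (Sym2 (Fin n)) | ∀ v : Fin n, ω ∈ openConnIn (↑A : Set (Fin n))ᶜ o v ↔ v ∈ S₀} ≤ 1 := by
  set T := (Finset.univ : Finset (Finset (Fin n))).filter (fun S₀ => o ∈ S₀ ∧ Disjoint S₀ A) with hT
  have hdisj : (↑T : Set (Finset (Fin n))).PairwiseDisjoint fun S₀ =>
      {ω : Set (Sym2 (Fin n)) | ∀ v : Fin n, ω ∈ openConnIn (↑A : Set (Fin n))ᶜ o v ↔ v ∈ S₀} := by
    intro S hS S' hS' hne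
    refine disjoint_left.2 fun ω hω hω' => hne ?_
    ext v
    exact (hω v).symm.trans (hω' v)
  rw [← measureReal_biUnion_finset hdisj fun _ _ => MeasurableSet.of_discrete]
  exact measureReal_le_one

/-! ### The per-pocket transfer -/

/-- **Hub/boundary transfer for the killed pairs** (Harris, three decreasing events): for a pocket value `S₀`,
a relay `a` and the target `b`,
`μ{a ↮ b in ω ∖ K(S₀)} · (μ(o ↮ a) · μ(every boundary pair of S₀ not at o is closed)) ≤ μ(a ↮ b)`:
an open path `a → b` either passes through `o` (then `o ↔ a`), or uses an open deep boundary pair, or lies in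
`ω ∖ K(S₀)`. -/
theorem killed_transfer (w : Sym2 (Fin n) → unitInterval) (S₀ A : Finset (Fin n)) (o a b : Fin n) :
    (prodBernoulli w).real
          {ω : Set (Sym2 (Fin n)) |
            ω \ {e : Sym2 (Fin n) | o ∈ e ∨ ∃ x ∈ S₀, ∃ y, y ∉ S₀ ∧ y ∉ A ∧ e = s(x, y)} ∉ openConn a b} *
        ((prodBernoulli w).real (openConn o a)ᶜ *
          (prodBernoulli w).real
            {ω : Set (Sym2 (Fin n)) | ∀ e : Sym2 (Fin n), o ∉ e →
              (∃ x ∈ S₀, ∃ y, y ∉ S₀ ∧ y ∉ A ∧ e = s(x, y)) → e ∉ ω}) ≤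
      (prodBernoulli w).real (openConn a b)ᶜ := by
  set μ := prodBernoulli w with hμ
  set K : Set (Sym2 (Fin n)) := {e | o ∈ e ∨ ∃ x ∈ S₀, ∃ y, y ∉ S₀ ∧ y ∉ A ∧ e = s(x, y)} with hK
  set D : Set (Set (Sym2 (Fin n))) := {ω | ω \ K ∉ openConn a b} with hD
  set E : Set (Set (Sym2 (Fin n))) := (openConn o a)ᶜ with hE
  set Cl : Set (Set (Sym2 (Fin n))) :=
    {ω | ∀ e : Sym2 (Fin n), o ∉ e → (∃ x ∈ S₀, ∃ y, y ∉ S₀ ∧ y ∉ A ∧ e = s(x, y)) → e ∉ ω} with hCl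
  have hDL : IsLowerSet D := fun ω ω' hle hω hω' =>
    hω (isUpperSet_openConn a b (sdiff_le_sdiff_right hle) hω')
  have hEL : IsLowerSet E := (isUpperSet_openConn o a).compl
  have hClL : IsLowerSet Cl := fun ω ω' hle hω e h1 h2 heω' => hω e h1 h2 (hle heω')
  -- the inclusion
  have hsub : D ∩ (E ∩ Cl) ⊆ (openConn a b)ᶜ := by
    rintro ω ⟨hD', hE', hCl'⟩ hab
    -- an open path from `a` to `b` in `ω`; it avoids `o` (else `o ↔ a`) and the deep boundary (closed),
    -- hence lives in `ω \ K`
    apply hD'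
    have hp : PathIn (openGraph ω) Set.univ a b := DCT16.pathIn_univ_of_reachable hab
    -- every vertex on the path is `≠ o`, propagated along the path together with reachability from `a`
    have hstep : ∀ x y : Fin n, x ∈ (Set.univ : Set (Fin n)) → y ∈ (Set.univ : Set (Fin n)) →
        ((openGraph ω).Reachable a x ∧ x ≠ o) → (openGraph ω).Adj x y →
          ((openGraph ω).Reachable a y ∧ y ≠ o) := by
      intro x y _ _ ⟨hax, _⟩ hxy
      refine ⟨hax.trans hxy.reachable, ?_⟩
      rintro rfl
      exact hE' ((hax.trans hxy.reachable).symm)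
    have hao : a ≠ o := by
      rintro rfl
      exact hE' (SimpleGraph.Reachable.refl _)
    -- transfer the path to the graph of `ω \ K`
    have hp' : PathIn (openGraph (ω \ K)) Set.univ a b := by
      refine ⟨mem_univ _, ?_⟩
      obtain ⟨-, hr⟩ := hp
      -- induction carrying the invariant `Reachable a x ∧ x ≠ o`
      suffices h : ∀ x, Relation.ReflTransGen (fun p q => (openGraph ω).Adj p q ∧ q ∈ (Set.univ : Set (Fin n))) a x →
          ((openGraph ω).Reachable a x ∧ x ≠ o) ∧
            Relation.ReflTransGen (fun p q => (openGraph (ω \ K)).Adj p q ∧ q ∈ (Set.univ : Set (Fin n))) a x from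
        (h b hr).2
      intro x hx
      induction hx with
      | refl => exact ⟨⟨SimpleGraph.Reachable.refl _, hao⟩, Relation.ReflTransGen.refl⟩
      | @tail y z _ hyz ih =>
        obtain ⟨⟨hay, hyo⟩, ih⟩ := ih
        have hz : (openGraph ω).Reachable a z ∧ z ≠ o := hstep y z (mem_univ _) (mem_univ _) ⟨hay, hyo⟩ hyz.1
        refine ⟨hz, ih.tail ⟨?_, mem_univ _⟩⟩
        rw [openGraph_adj] at hyz ⊢
        refine ⟨⟨hyz.1.1, ?_⟩, hyz.1.2⟩
        -- `s(y,z) ∉ K`: it does not contain `o`, and if it were a deep boundary pair it would be closed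
        rintro (hoe | hdeep)
        · rcases Sym2.mem_iff.1 hoe with h | h
          · exact hyo h.symm
          · exact hz.2 h.symm
        · have hoe : o ∉ s(y, z) := by
            intro h
            rcases Sym2.mem_iff.1 h with h | h
            · exact hyo h.symm
            · exact hz.2 h.symm
          exact hCl' _ hoe hdeep hyz.1.1
    exact DCT16.reachable_of_pathIn hp'
  calc μ.real D * (μ.real E * μ.real Cl)
      ≤ μ.real D * μ.real (E ∩ Cl) :=
        mul_le_mul_of_nonneg_left (prodBernoulli_harris_lower w hEL hClL MeasurableSet.of_discrete
          MeasurableSet.of_discrete) measureReal_nonneg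
    _ ≤ μ.real (D ∩ (E ∩ Cl)) :=
        prodBernoulli_harris_lower w hDL (hEL.inter hClL) MeasurableSet.of_discrete MeasurableSet.of_discrete
    _ ≤ μ.real (openConn a b)ᶜ := measureReal_mono hsub (measure_ne_top _ _)

/-! ### Admissible selection among the PORTS (appended) -/

/-- **An admissible selection with values among the PORTS** of the pocket shape: for every `S₀` having a relay
neighbour (a relay `v ∈ A` with a positive-weight pair from `S₀`), `sel S₀` is such a relay neighbour and minimises the
connection probability to `b` in `G − S₀` among them; for `S₀` without relay neighbours `sel S₀ = b`.  With this `sel` the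
boundary-budget bound `gluingDefect_le_sum` charges only ports of the pocket (Kozma–Nitzan Thm 4 with relay set = the ports),
never a far relay. -/
theorem exists_admissible_port (w : Sym2 (Fin n) → unitInterval) (A : Finset (Fin n)) {b : Fin n} (hb : b ∈ A) :
    ∃ sel : Finset (Fin n) → Fin n, (∀ S₀, sel S₀ ∈ A) ∧
      (∀ S₀ : Finset (Fin n), (∃ v ∈ A, ∃ x ∈ S₀, w s(x, v) ≠ 0) → ∃ x ∈ S₀, w s(x, sel S₀) ≠ 0) ∧
      ∀ S₀ : Finset (Fin n), ∀ v ∈ A, (∃ x ∈ S₀, w s(x, v) ≠ 0) →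
        (prodBernoulli (pinW w (edgesTouching (↑S₀ : Set (Fin n))) (∅ : Set (Sym2 (Fin n))))).real
            (openConn (sel S₀) b) ≤
          (prodBernoulli (pinW w (edgesTouching (↑S₀ : Set (Fin n))) (∅ : Set (Sym2 (Fin n))))).real
            (openConn v b) := by
  have key : ∀ S₀ : Finset (Fin n), ∃ a ∈ A, ((∃ v ∈ A, ∃ x ∈ S₀, w s(x, v) ≠ 0) → ∃ x ∈ S₀, w s(x, a) ≠ 0) ∧
      ∀ v ∈ A, (∃ x ∈ S₀, w s(x, v) ≠ 0) →
        (prodBernoulli (pinW w (edgesTouching (↑S₀ : Set (Fin n))) (∅ : Set (Sym2 (Fin n))))).real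
            (openConn a b) ≤
          (prodBernoulli (pinW w (edgesTouching (↑S₀ : Set (Fin n))) (∅ : Set (Sym2 (Fin n))))).real
            (openConn v b) := by
    intro S₀
    set P : Finset (Fin n) := A.filter (fun v => ∃ x ∈ S₀, w s(x, v) ≠ 0) with hP
    by_cases hne : P.Nonempty
    · obtain ⟨a, haP, hmin⟩ := Finset.exists_min_image P
        (fun a => (prodBernoulli (pinW w (edgesTouching (↑S₀ : Set (Fin n))) (∅ : Set (Sym2 (Fin n))))).real
          (openConn a b)) hne
      rw [hP, Finset.mem_filter] at haP
      refine ⟨a, haP.1, fun _ => haP.2, fun v hv hvx => hmin v ?_⟩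
      rw [hP, Finset.mem_filter]
      exact ⟨hv, hvx⟩
    · refine ⟨b, hb, fun ⟨v, hv, hvx⟩ => ?_, fun v hv hvx => ?_⟩
      · exact absurd ⟨v, by rw [hP, Finset.mem_filter]; exact ⟨hv, hvx⟩⟩ hne
      · exact absurd ⟨v, by rw [hP, Finset.mem_filter]; exact ⟨hv, hvx⟩⟩ hne
  choose sel hselA hport hsel using key
  exact ⟨sel, hselA, hport, hsel⟩

end BoundaryBudget

end Summit.CriticalPhenomena.PercolationContinuityZ3.Theorems
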